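import Summits.NavierStokesRegularity.NavierStokesRegularity.Theorems.ScenarioCensusRowA1F
import Literature.Analysis.FluidPDE.TypeIAncientMild
import Literature.Analysis.FluidPDE.SelfSimilarLiouville
import Literature.Analysis.Fourier.BohrAlmostPeriodic
import Summits.NavierStokesRegularity.NavierStokesRegularity.Theses.SymmetryModuliCount
import Summits.NavierStokesRegularity.NavierStokesRegularity.Theorems.ScenarioCensusAncient
import Summits.NavierStokesRegularity.NavierStokesRegularity.Theorems.SymmetryModuliCountFarPastLedger
import HarnessLib

/-!
# Census rows A1apT / A1trig (Bohr-almost-periodic / trigonometric slices, KNSS-gauge Type-I ancient) — part 1/2: the meter and the obligations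

Re-homed for the scenario census (typer seat ns-census-typer-1 g5; lead g7 MINT INTENT addendum ROW A1apT 17:34Z «port keys Row_A1apT / Row_A1trig
+ _excluded (free typer)», CLAIM 17:39Z) from ns-idea-2's LINE «bohr-meter» REV 6 (`pub/ideators/ns-idea-2/lines/bohr-meter/line-bohr-meter.lean`,
sha16 ea3d0b42683d7b31, 917 l., SORRY-FREE; crit 17:31:57Z ✓, ref PRE-CHECK §12.33 ✓, lit §21.12), the almost-periodic block (after `row_A1F_holds`,
landed as `ScenarioCensusRowA1FModes` / `ScenarioCensusRowA1F`), in two files for the 400-line rule: `ScenarioCensusRowA1apTMeter` (trig slices,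
S2 `ModeClosure` (hypothesis), `Row_A1trig`, the meter `upperMeanSq`, `IsBohrAP`, M1/M2/M3 Props, M2 `upperMeanSqLe_holds`, M3
`apVanishOfUpperMeanSqZero_holds` via the tree's `Fourier.IsBohrAlmostPeriodic`, `Row_A1apT`, `row_A1apT_of_stubs`) → `ScenarioCensusRowA1apT`
(`MeterNull` PROVED from the far-past ledger, `row_A1apT_holds`, M3trig `trigVanishOfUpperMeanSqZero_holds`, `row_A1trig_holds`, wall `Row_A1ap`;
census keys).  Lean text verbatim in namespace `…Theorems.ScenarioCensus.BohrMeter` (`R3` notation spelled out; `stub_*` aliases dropped;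
docstrings added where missing).

No census value is asserted here (the lead books A1apT / A1trig); NS regularity is NOT proved; (L′) / A1 stay OPEN; no summit statement is proved.
-/

noncomputable section

set_option linter.unusedVariables false
set_option linter.dupNamespace false
set_option linter.style.longLine false

namespace Summit.NavierStokesRegularity.NavierStokesRegularity.Theorems.ScenarioCensus.BohrMeter

open Set Function Filter Topology MeasureTheory Finset
open scoped BigOperators
open Literature.Analysis Literature.Analysis.FluidPDE
open Summit.NavierStokesRegularity.NavierStokesRegularity

/-- The slices of `u` are trigonometric polynomials with frequency set `S` and coefficient family `c`:
`u(t,x) = Σ_{n∈S} c_n(t) e^{i n·x}` componentwise (real parts agree because of the reality convention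
carried separately). -/
def HasTrigSlices (S : Finset (Fin 3 → ℝ)) (c : (Fin 3 → ℝ) → ℝ → (Fin 3 → ℂ))
    (u : ℝ → (EuclideanSpace ℝ (Fin 3)) → (EuclideanSpace ℝ (Fin 3))) : Prop :=
  ∀ t < 0, ∀ x : (EuclideanSpace ℝ (Fin 3)), ∀ i : Fin 3,
    ((u t x i : ℝ) : ℂ) =
      ∑ n ∈ S, c n t i * Complex.exp (Complex.I * (∑ j : Fin 3, ((n j : ℝ) : ℂ) * ((x j : ℝ) : ℂ)))

/-- **S2 `ModeClosure`** (obligation; analytic bookkeeping, M-sized): a Type-I ancient KNSS-mild solution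
whose slices are `S`-trigonometric polynomials (finite symmetric `S ∌ 0`, reality convention, zero
extension) has a coefficient family solving the bounded ancient Fourier-side system: the coefficients are
`C¹` (indeed smooth) in `t`, divergence-free, bounded by `C/√(−t₀)` on `(−∞,t₀]`, and the KNSS integral
equation on plane waves (heat multiplier `e^{−|n|²τ}`, Oseen symbol — tree `oseenSymbol`,
`OseenFlatComplex`) differentiates to `ċ_n + |n|²c_n + nonlin_n = 0` at every `n ≠ 0` (at unoccupied
`n ∈ (S+S)∖S` this says the projected interaction vanishes there, which a genuine solution satisfies).
Why it might fail: only if `KY.nonlin`'s normalisation (factor `i/2`, projection `P̂_n`) differs from the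
one produced by the Oseen kernel — a calibration to be checked on a two-mode example first. -/
def ModeClosure : Prop :=
  ∀ (C : ℝ) (u : ℝ → (EuclideanSpace ℝ (Fin 3)) → (EuclideanSpace ℝ (Fin 3))) (S : Finset (Fin 3 → ℝ)) (c : (Fin 3 → ℝ) → ℝ → (Fin 3 → ℂ)),
    IsTypeIAncientMild C u → (0 : Fin 3 → ℝ) ∉ S → (∀ n ∈ S, -n ∈ S) → (∀ n ∉ S, ∀ t, c n t = 0) →
      (∀ n t, c (-n) t = star (c n t)) → HasTrigSlices S c u → IsFiniteModeNSAncient S c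

/- REV 6: the optional obligation S2 `ModeClosure` is no longer carried as a sorried stub — rows A1trig / A1apT close
through M3 / M3trig (theorems); `row_A1trig_of_modeClosure : ModeClosure → Row_A1trig` keeps the alternative path as a
hypothesis-taking composition.  `ModeClosure` stays a `def` (an ASIDE: Fourier-side bookkeeping nobody needs now). -/

/-- **Row A1trig** (proposed census row; x-space, Type-I gauge class, decidable): a Type-I ancient mild
solution (KNSS gauge) whose slices are trigonometric polynomials with finitely many — possibly
incommensurate — frequencies is zero. -/
def Row_A1trig : Prop :=
  ∀ (C : ℝ) (u : ℝ → (EuclideanSpace ℝ (Fin 3)) → (EuclideanSpace ℝ (Fin 3))) (S : Finset (Fin 3 → ℝ)) (c : (Fin 3 → ℝ) → ℝ → (Fin 3 → ℂ)),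
    IsTypeIAncientMild C u → (0 : Fin 3 → ℝ) ∉ S → (∀ n ∈ S, -n ∈ S) → (∀ n ∉ S, ∀ t, c n t = 0) →
      (∀ n t, c (-n) t = star (c n t)) → HasTrigSlices S c u → ∀ t < 0, ∀ x, u t x = 0

/-- **Composition (PROVED): S2 ⇒ Row A1F ⇒ Row A1trig.** -/
theorem row_A1trig_of_stubs (hS2 : ModeClosure) (hF : Row_A1F) : Row_A1trig := by
  intro C u S c hu h0 hsym hoff hconj htrig t ht x
  have hc0 : ∀ n, c n t = 0 := fun n => hF S c (hS2 C u S c hu h0 hsym hoff hconj htrig) n t ht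
  ext i
  have h1 := htrig t ht x i
  simp only [hc0, Pi.zero_apply, zero_mul, Finset.sum_const_zero, Complex.ofReal_eq_zero] at h1
  simpa using h1

/-- Row A1trig from the obligations S1, S2 alone. -/
theorem row_A1trig_of_stubs' (hS1 : FourierEnergyNull) (hS2 : ModeClosure) : Row_A1trig :=
  row_A1trig_of_stubs hS2 (row_A1F_of_stubs hS1)

/-- REV 2: with S1 proved, rung `Row_A1trig` hinges on the single bookkeeping obligation S2. -/
theorem row_A1trig_of_modeClosure (hS2 : ModeClosure) : Row_A1trig :=
  row_A1trig_of_stubs hS2 row_A1F_holds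

/-- Bridge BY NAME (census lattice): the A-block hard core (L′) contains the cell. -/
theorem row_A1trig_of_typeIAncientLiouville (h : Theses.SymmetryModuliCount.TypeIAncientLiouville) :
    Row_A1trig :=
  fun C u S c hu _ _ _ _ _ => h C u (isTypeIAncientMild_iff.1 hu)

/-! ## 3. The meter: Wiener / Bohr upper mean square, and the almost-periodic cell -/

/-- The Wiener / Bohr UPPER MEAN SQUARE of a field: `limsup_{R→∞} ⨍_{B_R(0)} |f|²`.  (The `ℝ`-valued `limsup` is
the junk value `sInf ∅` when the ball averages are unbounded above; it is the genuine upper mean for slices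
with bounded ball averages — every use below is on bounded slices: Type-I gauge slices, and continuous Bohr-a.p.
fields, which are bounded.  Critic note N3, idea-crit-3 16:20:33Z.) -/
def upperMeanSq (f : (EuclideanSpace ℝ (Fin 3)) → (EuclideanSpace ℝ (Fin 3))) : ℝ :=
  Filter.limsup (fun R : ℝ => ⨍ x in Metric.ball (0 : (EuclideanSpace ℝ (Fin 3))) R, ‖f x‖ ^ 2) atTop

/-- Bohr almost periodicity of a field on `(EuclideanSpace ℝ (Fin 3))` (uniform: every `ε` has a relatively dense set of
`ε`-almost periods). -/
def IsBohrAP (f : (EuclideanSpace ℝ (Fin 3)) → (EuclideanSpace ℝ (Fin 3))) : Prop :=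
  ∀ ε > 0, ∃ L > 0, ∀ y : (EuclideanSpace ℝ (Fin 3)), ∃ τ : (EuclideanSpace ℝ (Fin 3)), ‖τ - y‖ ≤ L ∧ ∀ x, ‖f (x + τ) - f x‖ ≤ ε

/-- **M1 `UpperMeanSqQuasiAntitone`** (obligation; the load-bearing analytic lemma, M/L; RE-TYPED in REV 3 to
the weakest form the composition uses): along a Type-I ancient KNSS-mild solution the upper mean square of
the slice is QUASI-NON-INCREASING in time — `m⁺(u(t)) ≤ K · m⁺(u(s))` for `s ≤ t < 0` with a constant `K ≥ 0`
depending only on the solution (in fact `K = 8` universally).  Mechanism: the local energy identity for the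
smooth solution against the WIDE cutoff `φ(x/R)` (`φ = 1` on `B_1`, `supp φ ⊂ B_2`) on `[s,t]`, with the KNSS
pressure `p = R_iR_j(u_iu_j) ∈ L^∞_t BMO_x`: every flux term is `O(R²)` uniformly on `[s,t]`
(`∫|u|²|Δφ_R| = O(R)`, `∫|u|³|∇φ_R| = O(R²)`, `∫|p − p_{B_{2R}}||u||∇φ_R| ≤ R⁻¹‖u‖_∞|B_{2R}|‖p‖_{BMO} = O(R²)`),
so the `φ`-WEIGHTED upper mean `m⁺_φ(f) = limsup_R R⁻³∫|f|²φ_R` is non-increasing in `t`; and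
`|B_1| m⁺ ≤ m⁺_φ ≤ 8|B_1| m⁺` (from `1_{B_1} ≤ φ ≤ 1_{B_2}`) converts this into the quasi-monotonicity of the
sharp-ball meter with `K = 8`.  (The sharp statement `K = 1`, `UpperMeanSqAntitone` below, also follows — critic
note N2, idea-crit-3 16:20:33Z: use the cutoff FAMILY `1_{B_R} ≤ φ ≤ 1_{B_{(1+η)R}}`, get
`m⁺(t) ≤ (1+η)³ m⁺(s)` and let `η → 0` — but the obligation is kept in the weaker `∃ K` form the composition uses.)  Why it might fail: a KNSS-mild
solution whose pressure is NOT the Riesz one up to a time-dependent constant (excluded in the mild class by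
KNSS 2009 §4 / Seregin 2014 Prop 3.9, but the `L^∞BMO` bound must be uniform on `[s,t]`). -/
def UpperMeanSqQuasiAntitone : Prop :=
  ∀ (C : ℝ) (u : ℝ → (EuclideanSpace ℝ (Fin 3)) → (EuclideanSpace ℝ (Fin 3))), IsTypeIAncientMild C u →
    ∃ K : ℝ, 0 ≤ K ∧ ∀ s t : ℝ, s ≤ t → t < 0 → upperMeanSq (u t) ≤ K * upperMeanSq (u s)

/- REV 5: the former stub `stub_upperMeanSqQuasiAntitone` is now the THEOREM `upperMeanSqQuasiAntitone_holds`
(after `meterNull_holds`, §3 below). -/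

/-- The sharp form (REV 1's M1, `K = 1`; NOT an obligation since REV 3 — kept to record that the re-typed M1 is
WEAKER: `quasiAntitone_of_antitone`). -/
def UpperMeanSqAntitone : Prop :=
  ∀ (C : ℝ) (u : ℝ → (EuclideanSpace ℝ (Fin 3)) → (EuclideanSpace ℝ (Fin 3))), IsTypeIAncientMild C u → AntitoneOn (fun t => upperMeanSq (u t)) (Iio 0)

/-- Antitone ⇒ quasi-antitone. -/
theorem quasiAntitone_of_antitone (h : UpperMeanSqAntitone) : UpperMeanSqQuasiAntitone := by
  intro C u hu
  refine ⟨1, zero_le_one, fun s t hst ht => ?_⟩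
  rw [one_mul]
  exact h C u hu (show s ∈ Iio (0:ℝ) from lt_of_le_of_lt hst ht) (show t ∈ Iio (0:ℝ) from ht) hst

/-- **M2 `UpperMeanSqLe`** (obligation; routine, S): the Type-I bound `|u(t,x)| ≤ C/√(−t)` bounds every
ball average of `|u(t)|²`, hence the upper mean square, by `C²/(−t)`.  Why it might fail: it cannot
(averages of a function bounded by a constant are bounded by it; `limsup` of a bounded-below family). -/
def UpperMeanSqLe : Prop :=
  ∀ (C : ℝ) (u : ℝ → (EuclideanSpace ℝ (Fin 3)) → (EuclideanSpace ℝ (Fin 3))), IsTypeIAncientMild C u → ∀ t < 0, upperMeanSq (u t) ≤ C ^ 2 / (-t)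

/-- The ball average of a function with `0 ≤ g ≤ K` pointwise lies in `[0, K]` (no integrability needed). -/
theorem ball_avg_le_of_le {g : (EuclideanSpace ℝ (Fin 3)) → ℝ} {K : ℝ} (hK : 0 ≤ K) (hg0 : ∀ x, 0 ≤ g x) (hgK : ∀ x, g x ≤ K)
    (R : ℝ) : ⨍ x in Metric.ball (0 : (EuclideanSpace ℝ (Fin 3))) R, g x ≤ K := by
  rw [MeasureTheory.setAverage_eq, smul_eq_mul]
  have hfin : volume (Metric.ball (0 : (EuclideanSpace ℝ (Fin 3))) R) < ⊤ := measure_ball_lt_top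
  have hint : ‖∫ x in Metric.ball (0 : (EuclideanSpace ℝ (Fin 3))) R, g x‖ ≤ K * volume.real (Metric.ball (0 : (EuclideanSpace ℝ (Fin 3))) R) :=
    norm_setIntegral_le_of_norm_le_const hfin
      (fun x _ => by rw [Real.norm_of_nonneg (hg0 x)]; exact hgK x)
  by_cases h0 : volume.real (Metric.ball (0 : (EuclideanSpace ℝ (Fin 3))) R) = 0
  · rw [h0, inv_zero, zero_mul]; exact hK
  · have hpos : 0 < volume.real (Metric.ball (0 : (EuclideanSpace ℝ (Fin 3))) R) :=
      lt_of_le_of_ne measureReal_nonneg (Ne.symm h0)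
    calc (volume.real (Metric.ball (0 : (EuclideanSpace ℝ (Fin 3))) R))⁻¹ * ∫ x in Metric.ball (0 : (EuclideanSpace ℝ (Fin 3))) R, g x
        ≤ (volume.real (Metric.ball (0 : (EuclideanSpace ℝ (Fin 3))) R))⁻¹ * (K * volume.real (Metric.ball (0 : (EuclideanSpace ℝ (Fin 3))) R)) := by
          apply mul_le_mul_of_nonneg_left _ (inv_nonneg.2 hpos.le)
          exact (Real.le_norm_self _).trans hint
      _ = K := by rw [mul_comm K, inv_mul_cancel_left₀ h0]

/-- Ball averages of nonnegative functions are nonnegative. -/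
theorem ball_avg_nonneg {g : (EuclideanSpace ℝ (Fin 3)) → ℝ} (hg0 : ∀ x, 0 ≤ g x) (R : ℝ) :
    0 ≤ ⨍ x in Metric.ball (0 : (EuclideanSpace ℝ (Fin 3))) R, g x := by
  rw [MeasureTheory.setAverage_eq, smul_eq_mul]
  exact mul_nonneg (inv_nonneg.2 measureReal_nonneg)
    (setIntegral_nonneg measurableSet_ball (fun x _ => hg0 x))

/-- **M2 PROVED (REV 3).**  In the Type-I gauge every ball average of `|u(t)|²` is `≤ C²/(−t)`, hence so is
the upper mean square (`Filter.limsup_le_of_le`; coboundedness from the averages being `≥ 0`). -/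
theorem upperMeanSqLe_holds : UpperMeanSqLe := by
  intro C u hu t ht
  have hnt : 0 < -t := neg_pos.2 ht
  have hK : 0 ≤ C ^ 2 / (-t) := div_nonneg (sq_nonneg _) hnt.le
  have hpt : ∀ x, ‖u t x‖ ^ 2 ≤ C ^ 2 / (-t) := by
    intro x
    have h1 := hu.norm_le ht x
    have hsq : Real.sqrt (-t) ^ 2 = -t := Real.sq_sqrt hnt.le
    calc ‖u t x‖ ^ 2 ≤ (C / Real.sqrt (-t)) ^ 2 := pow_le_pow_left₀ (norm_nonneg _) h1 2
      _ = C ^ 2 / (-t) := by rw [div_pow, hsq]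
  have havg : ∀ R : ℝ, ⨍ x in Metric.ball (0 : (EuclideanSpace ℝ (Fin 3))) R, ‖u t x‖ ^ 2 ≤ C ^ 2 / (-t) := fun R =>
    ball_avg_le_of_le hK (fun x => sq_nonneg _) hpt R
  unfold upperMeanSq
  exact Filter.limsup_le_of_le
    (Filter.isCoboundedUnder_le_of_le atTop (x := 0) (fun R => ball_avg_nonneg (fun x => sq_nonneg _) R))
    (Filter.Eventually.of_forall havg)


/-- **M3 `APVanishOfUpperMeanSqZero`** (obligation; M): a continuous Bohr-almost-periodic field with zero
upper mean square vanishes identically (a bump `|f|² ≥ δ` on `B_r(x₀)` recurs, by the `(δ/2)`-almost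
periods, on a set of balls of positive upper density, so `m⁺(f) ≥ c δ (r/L)³ > 0`).  Why it might fail: it
cannot for Bohr a.p.; it WOULD fail for merely recurrent-along-a-sequence fields (zero density). -/
def APVanishOfUpperMeanSqZero : Prop :=
  ∀ f : (EuclideanSpace ℝ (Fin 3)) → (EuclideanSpace ℝ (Fin 3)), Continuous f → IsBohrAP f → upperMeanSq f ≤ 0 → f = 0

/-- **M3 PROVED (REV 6)** — the tree's `Literature.Analysis.Fourier.IsBohrAlmostPeriodic.eq_zero_of_limsup_ballAverage_sq_le`
(BohrAlmostPeriodic.lean, p650996; Corduneanu Thm 1.19: a non-vanishing continuous almost periodic function has a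
positive mean, run on the grid `2(L+r)ℤ³`).  `IsBohrAP` is VERBATIM the tree's `IsBohrAlmostPeriodic` and `upperMeanSq`
unfolds to its `limsup`, so the discharge is definitional. -/
theorem apVanishOfUpperMeanSqZero_holds : APVanishOfUpperMeanSqZero := fun f hc hap hm =>
  Fourier.IsBohrAlmostPeriodic.eq_zero_of_limsup_ballAverage_sq_le hc hap hm


/-- **Row A1apT** (proposed census row; Type-I gauge class, decidable by M1–M3): a Type-I ancient mild
solution (KNSS gauge) with Bohr-almost-periodic slices is zero.  Contains Row A1trig morally (trigonometric
polynomials are Bohr a.p. — Kronecker), every fully periodic (`𝕋³`-lattice) element, every quasi-periodic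
element; disjoint in hypothesis from all symmetry / window rows. -/
def Row_A1apT : Prop :=
  ∀ (C : ℝ) (u : ℝ → (EuclideanSpace ℝ (Fin 3)) → (EuclideanSpace ℝ (Fin 3))), IsTypeIAncientMild C u → (∀ t < 0, IsBohrAP (u t)) →
    ∀ t < 0, ∀ x, u t x = 0

/-- **Composition (PROVED): M1, M2, M3 ⇒ Row A1apT.**  The meter is quasi-antitone and `K·C²/(−s) → 0` as
`s → −∞`, hence it vanishes at every time; an a.p. slice with zero upper mean square is zero. -/
theorem row_A1apT_of_stubs (hM1 : UpperMeanSqQuasiAntitone) (hM2 : UpperMeanSqLe)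
    (hM3 : APVanishOfUpperMeanSqZero) : Row_A1apT := by
  intro C u hu hap t ht x
  obtain ⟨K, hK0, hK⟩ := hM1 C u hu
  -- the meter vanishes at time t
  have hm0 : upperMeanSq (u t) ≤ 0 := by
    have hbound : ∀ᶠ s in atBot, upperMeanSq (u t) ≤ K * C ^ 2 / (-s) := by
      filter_upwards [eventually_le_atBot t] with s hs
      have hs0 : s < 0 := lt_of_le_of_lt hs ht
      calc upperMeanSq (u t) ≤ K * upperMeanSq (u s) := hK s t hs ht
        _ ≤ K * (C ^ 2 / (-s)) := mul_le_mul_of_nonneg_left (hM2 C u hu s hs0) hK0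
        _ = K * C ^ 2 / (-s) := by ring
    have hlim : Tendsto (fun s : ℝ => K * C ^ 2 / (-s)) atBot (𝓝 0) :=
      tendsto_neg_atBot_atTop.const_div_atTop (K * C ^ 2)
    exact ge_of_tendsto hlim hbound
  have hzero := hM3 (u t) (hu.continuous_slice ht) (hap t ht) hm0
  simpa using congrFun hzero x

/-- REV 3: with M2 proved, rung `Row_A1apT` hinges on the meter lemma M1 and the Bohr lemma M3. -/
theorem row_A1apT_of_M1_M3 (hM1 : UpperMeanSqQuasiAntitone) (hM3 : APVanishOfUpperMeanSqZero) : Row_A1apT :=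
  row_A1apT_of_stubs hM1 upperMeanSqLe_holds hM3

end Summit.NavierStokesRegularity.NavierStokesRegularity.Theorems.ScenarioCensus.BohrMeter

end
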